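import Literature.Topology.FourManifolds.MMSWTwistedPictureNoTriple
import HarnessLib

/-!
# Velocities of the twisted picture at the points of a band

Sibling of `MMSWTwistedPictureNoTriple.lean`, towards the transversality of the NEW double points
of the twisted pictures `D(0⃗)(stripTwistAt_k ∘ K)` (the last axiom of `Knot.InGeneralPosition`
for them) and the named fact `Literature.Topology.FourManifolds.MMSW.eventually_approxHasRasmussen`
(Manolescu–Marengon–Sarkar–Willis, arXiv:1910.08195, Thm. 1.4 / Prop. 8.2 (i); §8.1 in the
tree's picture).  With `c(θ) = chartC (K₃.stereoCurve θ) = drawC (K(e^{iθ}))` the complex planar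
coordinate of the picture and `f = Re z` along the knot:

* `hasDerivAt_chartC_stereoCurve` — `c' = chartC (planeCurve', ·)`, and
  `cross u v = Im (conj (chartC u) · chartC v)` (`cross_eq_im_conj_mul`): plane-curve
  transversality in complex form;
* `hasDerivAt_norm_sq_complex`, `re_conj_mul_deriv_chartC` — the RADIAL identity
  `Re (conj c · c') = (f + C_r) f'` (from `|c| = f + C_r`);
* `twisted_chartC_eventuallyEq_lower` / `_upper` — near a LOWER point of the knot the twisted
  coordinate is `c`; near an UPPER point of the open window of band `j` it is
  `c · exp (2πi k · bandStep w (f - c_j - e_j))`;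
* `hasDerivAt_twisted_chartC_upper` — hence its velocity there is
  `c' m + c m · i · 2πk · bandStep' · f'` (`m` the unit phase).

Everything is proved; no definitions, no named facts.

## References

* C. Manolescu, M. Marengon, S. Sarkar, M. Willis, Duke Math. J. 172 (2023), arXiv:1910.08195,
  §2.1 and §8.1. [ManolescuMarengonSarkarWillis2023]
-/

open scoped Manifold ContDiff Topology ComplexConjugate
open Function Set Filter Complex

noncomputable section

namespace Literature.Topology.FourManifolds

/-- Local notation: `𝔼 n` is the model Euclidean space `EuclideanSpace ℝ (Fin n)`. -/
local notation "𝔼 " n:arg => EuclideanSpace ℝ (Fin n)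

/-- Local notation: `𝕊 n` is the unit sphere in `EuclideanSpace ℝ (Fin (n + 1))`. -/
local notation "𝕊 " n:arg => (Metric.sphere (0 : EuclideanSpace ℝ (Fin (n + 1))) 1)

namespace MMSW

open Literature.AlgebraicTopology.Homotopy.HopfFibration (zC wC ofZW zC_ofZW wC_ofZW ofZW_zC_wC)

variable {r : ℕ}

/-! ## Plane-curve velocities in complex form -/

/-- `chartC` of a pair with planar part `u`. [folklore] -/
theorem chartC_mk (u : ℝ × ℝ) (h : ℝ) : chartC (u, h) = (u.1 : ℂ) + (u.2 : ℂ) * I := rfl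

/-- **The velocity of the complex planar coordinate is `chartC` of the plane-curve velocity.**
[folklore] -/
theorem hasDerivAt_chartC_stereoCurve {K₃ : Knot} (hK : ∀ x, K₃ x ≠ northPole) (s : ℝ) :
    HasDerivAt (fun θ ↦ chartC (K₃.stereoCurve θ)) (chartC (deriv K₃.planeCurve s, 0)) s := by
  have hd : HasDerivAt K₃.planeCurve (deriv K₃.planeCurve s) s :=
    (((Knot.contDiff_planeCurve hK).differentiable (by simp)) s).hasDerivAt
  have h1 : HasDerivAt (fun θ ↦ ((K₃.planeCurve θ).1 : ℂ)) ((deriv K₃.planeCurve s).1 : ℂ) s :=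
    (Complex.ofRealCLM.hasFDerivAt.comp_hasDerivAt s hd.fst)
  have h2 : HasDerivAt (fun θ ↦ ((K₃.planeCurve θ).2 : ℂ)) ((deriv K₃.planeCurve s).2 : ℂ) s :=
    (Complex.ofRealCLM.hasFDerivAt.comp_hasDerivAt s hd.snd)
  have h := h1.add (h2.mul_const I)
  have heq : (fun θ ↦ chartC (K₃.stereoCurve θ)) =
      fun θ ↦ ((K₃.planeCurve θ).1 : ℂ) + ((K₃.planeCurve θ).2 : ℂ) * I := by
    funext θ
    rw [Knot.planeCurve_eq_fst_comp, comp_apply]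
    rfl
  rw [heq, chartC_mk]
  exact h

/-- The `2 × 2` determinant in complex form: `cross u v = Im (conj (chartC u) · chartC v)`.
[folklore] -/
theorem cross_eq_im_conj_mul (u v : ℝ × ℝ) (h h' : ℝ) :
    cross u v = (conj (chartC (u, h)) * chartC (v, h')).im := by
  simp [cross, chartC_mk, Complex.mul_im]
  ring

/-- Swapping the vectors changes the sign of the determinant. [folklore] -/
theorem cross_swap (u v : ℝ × ℝ) : cross v u = -cross u v := by
  simp only [cross]; ring

/-! ## The radial identity -/

/-- The derivative of `‖c‖²` for a complex-valued function of a real variable: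
`2 Re (conj c · c')`. [folklore] -/
theorem hasDerivAt_norm_sq_complex {c : ℝ → ℂ} {c' : ℂ} {s : ℝ} (hc : HasDerivAt c c' s) :
    HasDerivAt (fun θ ↦ ‖c θ‖ ^ 2) (2 * (conj (c s) * c').re) s := by
  have h1 : HasDerivAt (fun θ ↦ (c θ).re) c'.re s := Complex.reCLM.hasFDerivAt.comp_hasDerivAt s hc
  have h2 : HasDerivAt (fun θ ↦ (c θ).im) c'.im s := Complex.imCLM.hasFDerivAt.comp_hasDerivAt s hc
  have h := (h1.pow 2).add (h2.pow 2)
  have hfun : ((fun θ ↦ (c θ).re) ^ 2 + (fun θ ↦ (c θ).im) ^ 2) = fun θ ↦ ‖c θ‖ ^ 2 := by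
    funext θ
    simp only [Pi.add_apply, Pi.pow_apply, Complex.sq_norm, Complex.normSq_apply]
    ring
  rw [hfun] at h
  refine h.congr_deriv ?_
  simp only [Complex.mul_re, Complex.conj_re, Complex.conj_im]
  push_cast
  ring

/-- **The radial identity**: along a core-missing model knot,
`Re (conj c · c') = (Re z + C_r) · (Re z)'` for `c(θ) = chartC (K₃.stereoCurve θ)`. [folklore] -/
theorem re_conj_mul_deriv_chartC {K : 𝕊 1 → 𝔼 4} (hK : IsModelKnot r K) (hw : ∀ t, wC (K t) ≠ 0)
    {K₃ : Knot} (hK₃ : ⇑K₃ = finiteApprox r 0 K) (s : ℝ) :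
    (conj (chartC (K₃.stereoCurve s)) * chartC (deriv K₃.planeCurve s, 0)).re =
      ((zC (K (circlePoint s))).re + drawRadius r) *
        deriv (fun θ : ℝ ↦ (zC (K (circlePoint θ))).re) s := by
  have hne : ∀ x, K₃ x ≠ northPole := fun x ↦ ne_northPole_of_coe_eq_finiteApprox hK₃ x
  have h1 := hasDerivAt_norm_sq_complex (hasDerivAt_chartC_stereoCurve hne s)
  have heq : (fun θ ↦ ‖chartC (K₃.stereoCurve θ)‖ ^ 2) =
      fun θ ↦ ((zC (K (circlePoint θ))).re + drawRadius r) ^ 2 := by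
    funext θ; rw [norm_chartC_stereoCurve hK hw hK₃ θ]
  rw [heq] at h1
  have hfd : Differentiable ℝ fun θ : ℝ ↦ (zC (K (circlePoint θ))).re := by
    have hc : ContDiff ℝ ∞ fun θ : ℝ ↦ K (circlePoint θ) :=
      contMDiff_iff_contDiff.1 (hK.1.comp contMDiff_circlePoint)
    exact (Complex.reCLM.contDiff.comp (contDiff_zC.comp hc)).differentiable (by simp)
  have h2 : HasDerivAt (fun θ ↦ ((zC (K (circlePoint θ))).re + drawRadius r) ^ 2)
      (2 * ((zC (K (circlePoint s))).re + drawRadius r) *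
        deriv (fun θ : ℝ ↦ (zC (K (circlePoint θ))).re) s) s := by
    have h := ((hfd s).hasDerivAt.add_const (drawRadius r)).pow 2
    have hfun : ((fun θ ↦ (zC (K (circlePoint θ))).re + drawRadius r) ^ 2) =
        fun θ ↦ ((zC (K (circlePoint θ))).re + drawRadius r) ^ 2 := by
      funext θ; simp
    rw [hfun] at h
    refine h.congr_deriv ?_
    norm_num
  have h3 := h1.unique h2
  linarith

/-! ## The twisted coordinate near lower and upper points -/

/-- `Im z` along a model knot is continuous in the angle. [folklore] -/
theorem continuous_im_zC_comp {K : 𝕊 1 → 𝔼 4} (hK : IsModelKnot r K) :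
    Continuous fun θ : ℝ ↦ (zC (K (circlePoint θ))).im := by
  have h1 : Continuous fun θ : ℝ ↦ K (circlePoint θ) :=
    (contMDiff_iff_contDiff.1 (hK.1.comp contMDiff_circlePoint)).continuous
  exact Complex.continuous_im.comp ((contDiff_zC (n := ∞)).continuous.comp h1)

/-- **Near a lower point the twisted picture is the original one.** [folklore] -/
theorem twisted_chartC_eventuallyEq_lower {K : 𝕊 1 → 𝔼 4} (hK : IsModelKnot r K)
    {K₃ K₃k : Knot} (hK₃ : ⇑K₃ = finiteApprox r 0 K) {k : ℤ} {w : ℝ} (hw : 0 < w)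
    {e : Fin r → ℝ} (hK₃k : ⇑K₃k = finiteApprox r 0 (stripTwistAt r k w e ∘ K)) {s : ℝ}
    (hs : (zC (K (circlePoint s))).im < 0) :
    K₃k.planeCurve =ᶠ[𝓝 s] K₃.planeCurve := by
  have hev := (continuous_im_zC_comp hK).continuousAt.eventually (Iio_mem_nhds hs)
  filter_upwards [hev] with t ht
  have ht' : (zC (K (circlePoint t))).im < 0 := ht
  refine planeCurve_twisted_eq_of_apply_eq_one (φ := stripMultiplierAt r k w e) hK₃ hK₃k ?_
  exact stripMultiplierAt_eq_one hw fun j ↦ Or.inl ht'.le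

/-- The conjugate of the strip unit at an upper point is `exp (2πi k · bandStep)`. [folklore] -/
theorem conj_stripUnit_of_im_pos {ζ : ℂ} (hζ : 0 < ζ.im) (k : ℤ) (w : ℝ) :
    conj (stripUnit k w ζ) = exp (((2 * Real.pi * k * bandStep w ζ.re : ℝ) : ℂ) * I) := by
  rw [stripUnit, stripPhase, if_pos hζ, ← Complex.exp_conj, map_mul, Complex.conj_ofReal,
    Complex.conj_I]
  congr 1
  push_cast
  ring

/-- **Near an upper point of the open window of band `j` the twisted coordinate is
`c · exp (2πi k · bandStep w (f - c_j - e_j))`.** [folklore] -/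
theorem twisted_chartC_eventuallyEq_upper {K : 𝕊 1 → 𝔼 4} (hK : IsModelKnot r K)
    {K₃ K₃k : Knot} (hK₃ : ⇑K₃ = finiteApprox r 0 K) {k : ℤ} {w : ℝ} (hw : 0 < w)
    {e : Fin r → ℝ} (he : ∀ j, |e j| + w < 1)
    (hK₃k : ⇑K₃k = finiteApprox r 0 (stripTwistAt r k w e ∘ K)) {s : ℝ} {j : Fin r}
    (hwin : |(zC (K (circlePoint s))).re - (holeCentre r j).re - e j| < w)
    (hs : 0 < (zC (K (circlePoint s))).im) :
    (fun θ ↦ chartC (K₃k.stereoCurve θ)) =ᶠ[𝓝 s] fun θ ↦ chartC (K₃.stereoCurve θ) *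
      exp (((2 * Real.pi * k * bandStep w ((zC (K (circlePoint θ))).re - (holeCentre r j).re - e j)
        : ℝ) : ℂ) * I) := by
  have h1 : ∀ t, ‖stripMultiplierAt r k w e (zC (K t))‖ = 1 := fun t ↦ norm_stripMultiplierAt _ _ _ _
  have hev1 := (continuous_im_zC_comp hK).continuousAt.eventually (Ioi_mem_nhds hs)
  have hev2 : ∀ᶠ θ in 𝓝 s,
      |(zC (K (circlePoint θ))).re - (holeCentre r j).re - e j| < w := by
    have hc : Continuous fun θ : ℝ ↦ |(zC (K (circlePoint θ))).re - (holeCentre r j).re - e j| :=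
      ((continuous_re_zC_comp hK).sub continuous_const).sub continuous_const |>.abs
    exact hc.continuousAt.eventually (Iio_mem_nhds hwin)
  filter_upwards [hev1, hev2] with θ h1θ h2θ
  have h1θ' : 0 < (zC (K (circlePoint θ))).im := h1θ
  have h2θ' : |(zC (K (circlePoint θ))).re - (holeCentre r j).re - e j| < w := h2θ
  rw [chartC_stereoCurve_twisted (φ := stripMultiplierAt r k w e) hK₃ hK₃k h1 θ,
    stripMultiplierAt_eq_stripUnit he hw h2θ', conj_stripUnit_of_im_pos (by simpa [holeCentre] using h1θ')]
  simp

/-- The band step composed with `Re z - c_j - e_j` along the knot is differentiable, with the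
chain-rule derivative. [folklore] -/
theorem hasDerivAt_bandStep_comp {K : 𝕊 1 → 𝔼 4} (hK : IsModelKnot r K) (w a s : ℝ) :
    HasDerivAt (fun θ : ℝ ↦ bandStep w ((zC (K (circlePoint θ))).re - a))
      (deriv (bandStep w) ((zC (K (circlePoint s))).re - a) *
        deriv (fun θ : ℝ ↦ (zC (K (circlePoint θ))).re) s) s := by
  have hfd : Differentiable ℝ fun θ : ℝ ↦ (zC (K (circlePoint θ))).re := by
    have hc : ContDiff ℝ ∞ fun θ : ℝ ↦ K (circlePoint θ) :=
      contMDiff_iff_contDiff.1 (hK.1.comp contMDiff_circlePoint)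
    exact (Complex.reCLM.contDiff.comp (contDiff_zC.comp hc)).differentiable (by simp)
  have hB : HasDerivAt (bandStep w) (deriv (bandStep w) ((zC (K (circlePoint s))).re - a))
      ((zC (K (circlePoint s))).re - a) :=
    (((contDiff_bandStep w).differentiable (by simp)) _).hasDerivAt
  exact HasDerivAt.comp (h₂ := bandStep w) (h := fun θ : ℝ ↦ (zC (K (circlePoint θ))).re - a) s hB
    ((hfd s).hasDerivAt.sub_const a)

/-- **The velocity of the twisted coordinate at an upper point of the open window of band `j`.**
[folklore] -/
theorem hasDerivAt_twisted_chartC_upper {K : 𝕊 1 → 𝔼 4} (hK : IsModelKnot r K)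
    {K₃ K₃k : Knot} (hK₃ : ⇑K₃ = finiteApprox r 0 K) {k : ℤ} {w : ℝ} (hw : 0 < w)
    {e : Fin r → ℝ} (he : ∀ j, |e j| + w < 1)
    (hK₃k : ⇑K₃k = finiteApprox r 0 (stripTwistAt r k w e ∘ K)) {s : ℝ} {j : Fin r}
    (hwin : |(zC (K (circlePoint s))).re - (holeCentre r j).re - e j| < w)
    (hs : 0 < (zC (K (circlePoint s))).im) :
    HasDerivAt (fun θ ↦ chartC (K₃k.stereoCurve θ))
      (chartC (deriv K₃.planeCurve s, 0) *
          exp (((2 * Real.pi * k * bandStep w ((zC (K (circlePoint s))).re - (holeCentre r j).re - e j)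
            : ℝ) : ℂ) * I) +
        chartC (K₃.stereoCurve s) *
          (exp (((2 * Real.pi * k * bandStep w ((zC (K (circlePoint s))).re - (holeCentre r j).re - e j)
            : ℝ) : ℂ) * I) *
            (((2 * Real.pi * k * (deriv (bandStep w) ((zC (K (circlePoint s))).re - (holeCentre r j).re - e j) *
              deriv (fun θ : ℝ ↦ (zC (K (circlePoint θ))).re) s) : ℝ) : ℂ) * I))) s := by
  have hne : ∀ x, K₃ x ≠ northPole := fun x ↦ ne_northPole_of_coe_eq_finiteApprox hK₃ x
  have hc := hasDerivAt_chartC_stereoCurve hne s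
  -- the phase `m θ = exp (i · 2πk · B(f θ - c_j - e_j))`
  have hB := hasDerivAt_bandStep_comp hK w ((holeCentre r j).re + e j) s
  have hB' : HasDerivAt (fun θ : ℝ ↦ bandStep w ((zC (K (circlePoint θ))).re - (holeCentre r j).re - e j))
      (deriv (bandStep w) ((zC (K (circlePoint s))).re - (holeCentre r j).re - e j) *
        deriv (fun θ : ℝ ↦ (zC (K (circlePoint θ))).re) s) s := by
    have heq : (fun θ : ℝ ↦ bandStep w ((zC (K (circlePoint θ))).re - (holeCentre r j).re - e j)) =
        fun θ : ℝ ↦ bandStep w ((zC (K (circlePoint θ))).re - ((holeCentre r j).re + e j)) := by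
      funext θ; ring_nf
    rw [heq, show (zC (K (circlePoint s))).re - (holeCentre r j).re - e j =
      (zC (K (circlePoint s))).re - ((holeCentre r j).re + e j) by ring]
    exact hB
  have hexp : HasDerivAt (fun θ : ℝ ↦ exp (((2 * Real.pi * k *
      bandStep w ((zC (K (circlePoint θ))).re - (holeCentre r j).re - e j) : ℝ) : ℂ) * I))
      (exp (((2 * Real.pi * k * bandStep w ((zC (K (circlePoint s))).re - (holeCentre r j).re - e j)
          : ℝ) : ℂ) * I) *
        (((2 * Real.pi * k * (deriv (bandStep w) ((zC (K (circlePoint s))).re - (holeCentre r j).re - e j) *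
          deriv (fun θ : ℝ ↦ (zC (K (circlePoint θ))).re) s) : ℝ) : ℂ) * I)) s := by
    have h1 : HasDerivAt (fun θ : ℝ ↦ ((2 * Real.pi * k *
        bandStep w ((zC (K (circlePoint θ))).re - (holeCentre r j).re - e j) : ℝ) : ℂ) * I)
        ((((2 * Real.pi * k * (deriv (bandStep w) ((zC (K (circlePoint s))).re - (holeCentre r j).re - e j) *
          deriv (fun θ : ℝ ↦ (zC (K (circlePoint θ))).re) s)) : ℝ) : ℂ) * I) s := by
      have h2 := (hB'.const_mul (2 * Real.pi * k))
      have h3 := (Complex.ofRealCLM.hasFDerivAt.comp_hasDerivAt s h2).mul_const I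
      simp only [Function.comp_def, Complex.ofRealCLM_apply] at h3
      exact h3
    exact h1.cexp
  have h := (hc.mul hexp).congr_of_eventuallyEq (twisted_chartC_eventuallyEq_upper hK hK₃ hw he hK₃k hwin hs)
  exact h

end MMSW

end Literature.Topology.FourManifolds

end
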